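import Summits.Ventures.PercRepro.S1TailJ2
import Summits.Ventures.PercRepro.S1LevelFourD

/-!
# PercRepro — S1 LEVEL FOUR, PHASE 5: C-025 at level `4` for every finite matroid and every `p ≥ 19` (p2, gen 15;
SUBCLAIM-S1 with LEMMAS J and J′)

The `Π′` cell inequality (`S1CellTableJ2.cellOK4`: the joint budget with the pairs avoiding their circuit) closes every
core cell `(p, d)` with `19 ≤ p ≤ 20`: `5 ≤ d ≤ 15` by `table_19_20`, `16 ≤ d ≤ 400` by `table_19_20_16_400`,
`d ≥ 401` by `cellOK4_of_tail`. With the cores of rank `≥ 21` (`S1LevelFourD.c025_core_four_all_corank21`) the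
`e`-free core is closed at EVERY `p ≥ 19` and every corank, so `ThmN.rls_succ_large 3 4 19` gives level `4` at every
`p ≥ 20` and `S1FixedFrame.rls_succ_fixed 3 4 19` gives `p = 19`.

* `c025_core_four_cellJ'` — the core cells `19 ≤ p ≤ 20`, every `d ≥ 5`;
* `c025_core_four_all_corank19` — the core at every `p ≥ 19`, every corank `≥ 5`;
* `c025_four_twenty` — `ThmN.RLS M p 4` for `p ≥ 20`; `c025_four_nineteen_fixed` — at `p = 19`;
* **`c025_four_nineteen`** — THE END THEOREM: `ThmN.RLS M p 4` for every finite matroid and every `p ≥ 19`;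
  `c025_four_nineteen'` — the literal `C025` body.
Axioms: standard.
-/

open scoped Matroid

namespace PercRepro

namespace S1

variable {α : Type}

/-- **The `Π′` core cells `19 ≤ p ≤ 20`, every corank `d ≥ 5`.** -/
theorem c025_core_four_cellJ' (M : Matroid α) [M.Finite] (p d : ℕ) (hp : 19 ≤ p) (hp' : p ≤ 20)
    (hd : 5 ≤ d) (hR : M.eRank = (p : ℕ∞)) (hn : M.E.ncard = p + d)
    (hfree : ∀ e ∈ M.E, ∃ A ⊆ M.E \ {e}, e ∉ M.closure A ∧ e ∉ M.closure ((M.E \ {e}) \ A)) :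
    ThmN.RLS M p 4 := by
  rcases Nat.lt_or_ge d 16 with h16 | h16
  · exact rls_of_cellOK4 M p d hR hn hfree (by omega) (table_19_20 p hp hp' d hd (by omega))
  rcases Nat.lt_or_ge d 401 with h401 | h401
  · exact rls_of_cellOK4 M p d hR hn hfree (by omega) (table_19_20_16_400 p (by omega) hp d h401 h16)
  · exact rls_of_cellOK4 M p d hR hn hfree (by omega) (cellOK4_of_tail p d hp hp' h401)

/-- **The `e`-free core at rank `p ≥ 19` and every corank `≥ 5`.** -/
theorem c025_core_four_all_corank19 (M : Matroid α) [M.Finite] (p : ℕ) (hp : 19 ≤ p)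
    (hR : M.eRank = (p : ℕ∞)) (hbig : p + 4 < M.E.ncard)
    (hfree : ∀ e ∈ M.E, ∃ A ⊆ M.E \ {e}, e ∉ M.closure A ∧ e ∉ M.closure ((M.E \ {e}) \ A)) :
    ThmN.RLS M p 4 := by
  rcases Nat.lt_or_ge p 21 with h20 | h21
  · exact c025_core_four_cellJ' M p (M.E.ncard - p) hp (by omega) (by omega) hR (by omega) hfree
  · exact c025_core_four_all_corank21 M p h21 hR hbig hfree

/-- **Level `4` for every `p ≥ 20`** (night-1's wrapper at threshold `19`). -/
theorem c025_four_twenty (M : Matroid α) [M.Finite] (p : ℕ) (hp : 20 ≤ p) : ThmN.RLS M p 4 := by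
  refine ThmN.rls_succ_large (α := α) 3 4 19 ?_ ?_ ?_ M p hp (by omega)
  · intro M' _ p' _ hp'
    exact SevenThree.c025_three_all M' p' (by omega)
  · intro M' _ p' _ hn _
    rcases Nat.lt_or_ge M'.E.ncard (p' + 4) with h | h
    · exact ThmN.RLS_of_ncard_lt M' h
    · exact ThmN.RLS_of_ncard_eq M' (by omega)
  · intro M' _ p' hP hR hbig _ hfree
    exact c025_core_four_all_corank19 M' p' hP hR hbig hfree

/-- **Level `4` at rank `19`** (the fixed-rank frame). -/
theorem c025_four_nineteen_fixed (M : Matroid α) [M.Finite] : ThmN.RLS M 19 4 := by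
  refine rls_succ_fixed (α := α) 3 4 19 (by omega) ?_ ?_ ?_ M
  · intro M' _
    exact SevenThree.c025_three_all M' 18 (by omega)
  · intro M' _ hn
    rcases Nat.lt_or_ge M'.E.ncard (19 + 4) with h | h
    · exact ThmN.RLS_of_ncard_lt M' h
    · exact ThmN.RLS_of_ncard_eq M' (by omega)
  · intro M' _ hR hbig hfree
    exact c025_core_four_all_corank19 M' 19 (le_refl _) hR hbig hfree

/-- **THE END THEOREM OF PHASE 5**: every finite matroid satisfies C-025 at level `4` for every `p ≥ 19`:
`Φ(p, 4)·#{A ⊆ E : r(A) = p, r(E ∖ A) = 4} ≤ #{A ⊆ E : 4 < r(A) < p}`. -/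
theorem c025_four_nineteen (M : Matroid α) [M.Finite] (p : ℕ) (hp : 19 ≤ p) : ThmN.RLS M p 4 := by
  rcases Nat.lt_or_ge p 20 with h | h
  · have hp19 : p = 19 := by omega
    subst hp19
    exact c025_four_nineteen_fixed M
  · exact c025_four_twenty M p h

/-- The phase-5 theorem in the literal vocabulary of `C025` (the body at `(p, 4)`). -/
theorem c025_four_nineteen' (M : Matroid α) [M.Finite] (p : ℕ) (hp : 19 ≤ p) :
    phiK p 4 * ({A : Set α | A ⊆ M.E ∧ M.eRk A = (p : ℕ∞) ∧ M.eRk (M.E \ A) = (4 : ℕ∞)}.ncard : ℚ) ≤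
      ({A : Set α | A ⊆ M.E ∧ (4 : ℕ∞) < M.eRk A ∧ M.eRk A < (p : ℕ∞)}.ncard : ℚ) :=
  c025_four_nineteen M p hp

end S1

end PercRepro
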